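import Literature.Probability.LatticeModels.ManeuverChain
import HarnessLib

/-!
# The refined chain inequality: analytic strong Markov property with a target set
(line `symplectic-fermion-anchor`, crux `SAWLoopFugacityFlow.AvoidanceLimit`, stmt-CriticalPhenomena-10649)

Free nearest-neighbour walk on `ℤ²`, vertex formalism of `ManeuverChain.lean`: a maneuver
(exit the rectangle `U₀` through the landing set `L₀`, then `U₁` through `L₁`, …) is encoded by the
chain of harmonic extensions `M_j = chainM U L n j` (indexed by the number `j` of remaining steps),
its version killed on `Sᶜ` by `N_j = chainN U L S n j`.  `chainM_sub_chainN_le_killedIn` bounds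
`M_j - N_j` by the probability of being killed before leaving a finite region `W`; here the killing is
refined to a TARGET SET `A` disjoint from `S`: if from every site of `U i ∩ S` each lattice neighbour
lies in `S`, or in `A`, or outside `U i ∪ L i` (so that a walk performing step `i` of the maneuver can
leave `S` only through `A` or by aborting the maneuver), then on `S`

  `M_j x - N_j x ≤ harmExt (S ∩ W) 𝟙_A x`,

the probability that the free walk from `x` leaves `S ∩ W` through `A` (`chainM_sub_chainN_le_harmExt_hit`).
This is the analytic form of the strong Markov property "performing the maneuver but not inside `S`
forces a visit to `A`" used by the shield lemma of the anchor line (after D. Chelkak, *Robust discrete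
complex analysis: a toolbox*, Ann. Probab. 44 (2016), Lemma 2.14, and S. Smirnov, Ann. of Math. 172
(2010), Lemma B.2 [Smirnov2010]).

Proof: downward induction on the step (upward on `j`) and the comparison principle
`le_of_sub_super_of_boundary` on the finite set `U i ∩ S`, where `M_{j+1} - N_{j+1}` is harmonic and
`F = harmExt (S ∩ W) 𝟙_A` is harmonic (`U i ⊆ W`); on the outer boundary `w = v + e_k` the three
cases of the hypothesis give `w ∈ S ∖ U i` (both chains equal their data: induction hypothesis or
`0 ≤ F`), `w ∈ A` (`F w = 1 ≥ M - N`), or `w ∉ U i ∪ L i` (both chains vanish).  Everything is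
proved; no definitions. [folklore]
-/

noncomputable section

open scoped BigOperators Classical
open Finset Literature.Probability.LatticeModels

namespace Summit.CriticalPhenomena.SAWScalingLimit.Theorems.AvoidanceLimit.Anchor

/-- **Refined chain inequality (analytic strong Markov property with a target set).** For the free
chain `M_j = chainM U L n j` of a maneuver and its version `N_j = chainN U L S n j` killed on `Sᶜ`
(finite rectangles `U i` inside the finite region `W`), a target set `A` disjoint from `S`, and the
exit condition "every lattice neighbour of a site of `U i ∩ S` lies in `S`, in `A`, or outside
`U i ∪ L i`", one has `M_j x - N_j x ≤ harmExt (S ∩ W) 𝟙_A x` for every `x ∈ S`: performing the rest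
of the maneuver without staying in `S` is at most as likely as leaving `S ∩ W` through `A`.
(The hypotheses `L i ⊆ W` and `Disjoint (U i) (L i)` of `chainM_sub_chainN_le_killedIn` are kept in
the signature but not needed.) [folklore] -/
theorem chainM_sub_chainN_le_harmExt_hit :
    ∀ (U L : ℕ → Set (Site 2)) (S A W : Set (Site 2)) (n : ℕ), (∀ i, (U i).Finite) → W.Finite →
      (∀ i, U i ⊆ W) → (∀ i, L i ⊆ W) → (∀ i, Disjoint (U i) (L i)) → Disjoint S A →
      (∀ i, ∀ v ∈ U i ∩ S, ∀ k : Fin 4,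
        v + cornerUnit k ∈ S ∨ v + cornerUnit k ∈ A ∨ (v + cornerUnit k ∉ U i ∧ v + cornerUnit k ∉ L i)) →
      ∀ (j : ℕ) (x : Site 2), x ∈ S →
        chainM U L n j x - chainN U L S n j x ≤ harmExt (S ∩ W) (fun w => if w ∈ A then (1 : ℝ) else 0) x := by
  intro U L S A W n hU hW hUW _ _ hSA hnb j
  -- the comparison function `F = harmExt (S ∩ W) 𝟙_A`: harmonic on `S ∩ W`, `0 ≤ F`, `F = 1` on `A`
  have hfinW : (S ∩ W).Finite := hW.subset Set.inter_subset_right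
  set F : Site 2 → ℝ := harmExt (S ∩ W) (fun w => if w ∈ A then (1 : ℝ) else 0) with hF
  have hF0 : ∀ y, 0 ≤ F y := fun y => by
    rw [hF]; exact le_harmExt' hfinW (fun w => by split_ifs <;> norm_num) y
  have hFA : ∀ y ∈ A, F y = 1 := fun y hyA => by
    have hyS : y ∉ S := fun hyS => Set.disjoint_left.1 hSA hyS hyA
    rw [hF, harmExt_of_not_mem hfinW _ (fun h => hyS h.1), if_pos hyA]
  induction j with
  | zero => intro x _; simp only [chainM, chainN, sub_self]; exact hF0 x
  | succ j ih =>
    intro x hxS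
    set i := n - 1 - j
    have hfinS : (U i ∩ S).Finite := (hU i).subset Set.inter_subset_left
    -- the data of the two chains at step `i`
    set gM : Site 2 → ℝ := fun w => if w ∈ L i then chainM U L n j w else 0 with hgM
    set gN : Site 2 → ℝ := fun w => if w ∈ L i ∧ w ∈ S then chainN U L S n j w else 0 with hgN
    have hM : chainM U L n (j + 1) = harmExt (U i) gM := rfl
    have hN : chainN U L S n (j + 1) = harmExt (U i ∩ S) gN := rfl
    -- on `S` off the rectangle `U i`: both chains equal their data
    have hoffS : ∀ y ∈ S, y ∉ U i → chainM U L n (j + 1) y - chainN U L S n (j + 1) y ≤ F y := by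
      intro y hyS hyU
      rw [hM, hN, harmExt_of_not_mem (hU i) _ hyU, harmExt_of_not_mem hfinS _ (fun h => hyU h.1), hgM, hgN]
      simp only
      by_cases hyL : y ∈ L i
      · simp only [hyL, hyS, and_self, if_true]; exact ih y hyS
      · simp only [hyL, false_and, if_false, sub_zero]; exact hF0 y
    -- off the rectangle and off the landing set: both chains vanish
    have hoff0 : ∀ y, y ∉ U i → y ∉ L i → chainM U L n (j + 1) y - chainN U L S n (j + 1) y ≤ F y := by
      intro y hyU hyL
      rw [hM, hN, harmExt_of_not_mem (hU i) _ hyU, harmExt_of_not_mem hfinS _ (fun h => hyU h.1), hgM, hgN]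
      simp only [hyL, false_and, if_false, sub_zero]; exact hF0 y
    -- on the target set: `M ≤ 1 = F` and `0 ≤ N`
    have hoffA : ∀ y ∈ A, chainM U L n (j + 1) y - chainN U L S n (j + 1) y ≤ F y := by
      intro y hyA
      rw [hFA y hyA]
      linarith [(chainM_mem_Icc (L := L) (n := n) hU (j + 1) y).2,
        (chainN_mem_Icc (L := L) (S := S) (n := n) hU (j + 1) y).1]
    by_cases hxU : x ∈ U i
    · -- inside: comparison principle for the harmonic `M - N` against the harmonic `F` on `U i ∩ S`
      have hx : x ∈ U i ∩ S := ⟨hxU, hxS⟩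
      have hharm : IsLatticeSubharmonicOn (fun y => chainM U L n (j + 1) y - chainN U L S n (j + 1) y) (U i ∩ S) := by
        intro y hy
        rw [show (fun y => chainM U L n (j + 1) y - chainN U L S n (j + 1) y) =
            chainM U L n (j + 1) - chainN U L S n (j + 1) from rfl,
          latticeLaplacian_sub, hM, hN, harmExt_harmonicOn (hU i) gM y hy.1, harmExt_harmonicOn hfinS gN y hy]
        simp
      have hsup : IsLatticeSuperharmonicOn F (U i ∩ S) := by
        intro y hy
        rw [hF, harmExt_harmonicOn hfinW _ y ⟨hy.2, hUW i hy.1⟩]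
      have hb : ∀ w ∈ latticeOuterBoundary (U i ∩ S),
          (fun y => chainM U L n (j + 1) y - chainN U L S n (j + 1) y) w ≤ F w + 0 := by
        rintro w ⟨hwD, v, hv, k, rfl⟩
        rw [add_zero]
        rcases hnb i v hv k with hwS | hwA | ⟨hwU, hwL⟩
        · exact hoffS _ hwS (fun h => hwD ⟨h, hwS⟩)
        · exact hoffA _ hwA
        · exact hoff0 _ hwU hwL
      have := le_of_sub_super_of_boundary hfinS hharm hsup (c := 0) hb x hx
      simpa using this
    · exact hoffS x hxS hxU

end Summit.CriticalPhenomena.SAWScalingLimit.Theorems.AvoidanceLimit.Anchor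

end
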